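import Mathlib
import Summits.ValiantsHypothesis.ValiantsHypothesis.Theses.FeketeSOS
import Summits.ValiantsHypothesis.ValiantsHypothesis.Theorems.FeketeSOSCharPSparseSOSTwoCuspTrivial
import Summits.ValiantsHypothesis.ValiantsHypothesis.Theorems.FeketeSOSCharPSparseSOSTwoCuspTwoMonomialSquares

/-!
# Crux `FeketeSOS.CharPSparseSOS` (stmt-ValiantsHypothesis-14989) — the ORDERED door, (★)-side

The crux-strategist of this crux (`Cruxes/CharPSparseSOS/STRATEGY-CENSUS.md` §0/§R, scratch file
`Cruxes/CharPSparseSOS/Strategist_Sketch.lean`, not importable) certified a route-level exit from the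
square-root wall of the crux (★) `CharPSparseSOS`: re-glue the route's deciding theorem through the ORDERED
pair — (★ord) `CharPSparseSOSOrdered` (an EXACT identity `Σ C(c_i)·g_i² = F̄_p` in `K[X]`, `deg g_i ≤ p²`,
`s ≤ p^δ` squares, no reduction modulo `X^p − 1`) and `SublinearShadowOrdered` (item 14990 with its conclusion
kept exact).  The 14990-side of that door is in the tree (`Theorems/FeketeSOSSublinearShadowOrderedBridge.lean`:
`sublinearShadow_of_ordered`, `depthZeroShadow_ordered`).  This file lands the (★)-side, with the two ordered
bodies INLINED VERBATIM (the strategist's `def`s live under `Cruxes/`), so that the planner's re-glue is a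
single `route edit --closes-file` whose body is one application of `valiantsHypothesis_of_ordered`:

* `od_fold_sq_dvd` — folding a polynomial modulo `X^p − 1` changes `C c · g²` by a multiple of `X^p − 1`.
* `charPSparseSOSOrdered_of_charPSparseSOS` — **(★) ⇒ (★ord)**: the ordered shadow is WEAKER than the filed
  crux (fold every `g_i` modulo `X^p − 1`: degree `< p`, no more monomials, same weights; tree lemmas
  `tcm_natDegree_fold_lt`, `card_support_fold_le`).  So nothing proved about (★) is lost by the re-glue, and every
  landed consequence of (★) (the wall theorems `coreSumClique_of_charPSparseSOS`, `robustNoPacking_of_charPSparseSOS`,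
  …) stays a theorem about folds of ordered representations.
* `feketeSOSHard_of_ordered` — **(★ord) + SublinearShadowOrdered ⇒ X** (`FeketeSOSHard`, stmt-3996): the route's
  own `closes` real-exponent bookkeeping (`δ := min (1/4) (δ'/(2(A+1)))`, `p ≥ max p₀' p₁ ⌈(2^A)^{2/δ'}⌉ 2`), with the
  exact conclusion of the ordered shadow fed to (★ord) instead of the cyclic one fed to (★).
* `valiantsHypothesis_of_ordered` — the re-glued deciding theorem shape:
  `SOSMagnification → (★ord) → SublinearShadowOrdered → ValiantsHypothesis`.

Adapted from `Cruxes/CharPSparseSOS/Strategist_Sketch.lean` (strategist p1, rc 0 there); lead c7 of the crux,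
`--supports stmt-ValiantsHypothesis-14989`.  Nothing here bears on the open residual of line `Sketch`
(`stub_twoCuspInequality` ≡ the crux at full depth, p115769); see `Cruxes/CharPSparseSOS/Lines/Sketch-dead*.md`.
-/

-- `Summit.ValiantsHypothesis.ValiantsHypothesis.…` is the tree's mandated single-conjunct layout (Sub = Summit).
set_option linter.dupNamespace false

namespace Summit.ValiantsHypothesis.ValiantsHypothesis.Theorems.CharPSparseSOSTwoCusp

open Polynomial Finset
open Summit.ValiantsHypothesis.ValiantsHypothesis.Theses.FeketeSOS

/-! ## Folding an exact representation -/

/-- Folding `g` modulo `X^p − 1` changes `g²` — hence `C c · g²` — by a multiple of `X^p − 1`. [folklore] -/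
theorem od_fold_sq_dvd {K : Type} [Field K] (p : ℕ) (c : K) (g : K[X]) :
    (X : K[X]) ^ p - 1 ∣ C c * (g %ₘ ((X : K[X]) ^ p - 1)) ^ 2 - C c * g ^ 2 := by
  rw [← mul_sub]
  apply Dvd.dvd.mul_left
  have hq : ((X : K[X]) ^ p - 1) ∣ (g %ₘ ((X : K[X]) ^ p - 1)) - g := by
    have := Polynomial.modByMonic_add_div g ((X : K[X]) ^ p - 1 : K[X])
    exact ⟨-(g /ₘ ((X : K[X]) ^ p - 1)), by linear_combination this⟩
  have : (g %ₘ ((X : K[X]) ^ p - 1)) ^ 2 - g ^ 2 =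
      ((g %ₘ ((X : K[X]) ^ p - 1)) - g) * ((g %ₘ ((X : K[X]) ^ p - 1)) + g) := by ring
  rw [this]
  exact Dvd.dvd.mul_right hq _

/-- Pointwise direction check: an EXACT representation `Σ C(c_i)·g_i² = F̄_p` in `K[X]` folds to a CYCLIC one,
`X^p − 1 ∣ Σ C(c_i)·(g_i mod (X^p − 1))² − F̄_p`. [folklore] -/
theorem od_fold_rep_dvd (K : Type) [Field K] (p : ℕ) [Fact p.Prime] (s : ℕ) (c : Fin s → K) (g : Fin s → Polynomial K)
    (h : (∑ i, Polynomial.C (c i) * g i ^ 2) =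
      ∑ m ∈ Finset.range p, Polynomial.C ((legendreSym p m : ℤ) : K) * Polynomial.X ^ m) :
    (Polynomial.X : Polynomial K) ^ p - 1 ∣
      (∑ i, Polynomial.C (c i) * (g i %ₘ ((Polynomial.X : Polynomial K) ^ p - 1)) ^ 2) -
        ∑ m ∈ Finset.range p, Polynomial.C ((legendreSym p m : ℤ) : K) * Polynomial.X ^ m := by
  rw [← h, ← Finset.sum_sub_distrib]
  exact Finset.dvd_sum fun i _ => od_fold_sq_dvd p (c i) (g i)

/-! ## (★) ⇒ (★ord): the ordered shadow is the weaker statement -/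

/-- **The ordered shadow (★ord) is WEAKER than the filed crux (★).**  The conclusion is the body of the
strategist's `CharPSparseSOSOrdered` (`Cruxes/CharPSparseSOS/Strategist_Sketch.lean`), verbatim: for some
`δ > 0` and all large primes `p`, every EXACT representation `Σ_{i<s} C(c_i)·g_i² = F̄_p` in `K[X]` over a field
`K` of characteristic `p` with `s ≤ p^δ` and `deg g_i ≤ p²` has support-sum `Σ_i |supp g_i| ≥ p^{1/2+δ}`.
Proof: fold each `g_i` modulo `X^p − 1` (degree `< p`, support does not grow) and apply `CharPSparseSOS`, with
the same `δ` and `p₀`, to the folded cyclic representation. -/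
theorem charPSparseSOSOrdered_of_charPSparseSOS : Summit.ValiantsHypothesis.ValiantsHypothesis.Theses.FeketeSOS.CharPSparseSOS → ∃ δ : ℝ, 0 < δ ∧ ∃ p₀ : ℕ, ∀ (p : ℕ) [Fact p.Prime], p₀ ≤ p → ∀ (K : Type) [Field K] [CharP K p] (s : ℕ) (c : Fin s → K) (g : Fin s → Polynomial K), (s : ℝ) ≤ (p : ℝ) ^ δ → (∀ i, (g i).natDegree ≤ p ^ 2) → (∑ i, Polynomial.C (c i) * g i ^ 2) = ∑ m ∈ Finset.range p, Polynomial.C ((legendreSym p m : ℤ) : K) * Polynomial.X ^ m → (p : ℝ) ^ (1 / 2 + δ) ≤ ∑ i, ((g i).support.card : ℝ) := by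
  intro h
  obtain ⟨δ, hδ, p₀, H⟩ := h
  refine ⟨δ, hδ, p₀, ?_⟩
  intro p hpFact hp K _ _ s c g hs _hdeg heq
  have hprime : p.Prime := Fact.out
  set g' : Fin s → Polynomial K := fun i => g i %ₘ ((Polynomial.X : Polynomial K) ^ p - 1) with hg'
  have hdeg' : ∀ i, (g' i).natDegree < p := fun i => tcm_natDegree_fold_lt p (g i)
  have hdvd' : (Polynomial.X : Polynomial K) ^ p - 1 ∣ (∑ i, Polynomial.C (c i) * g' i ^ 2) -
      ∑ m ∈ Finset.range p, Polynomial.C ((legendreSym p m : ℤ) : K) * Polynomial.X ^ m :=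
    od_fold_rep_dvd K p s c g heq
  refine (H p hp K s c g' hs hdeg' hdvd').trans ?_
  exact Finset.sum_le_sum fun i _ => by
    exact_mod_cast card_support_fold_le p hprime.pos (g i)

/-! ## (★ord) + SublinearShadowOrdered ⇒ X: the re-glue through the ordered pair -/

/-- **The thesis X from the ORDERED pair.**  Hypotheses: the body of (★ord) `CharPSparseSOSOrdered` and the body
of `SublinearShadowOrdered` (item `SublinearShadow`, stmt-14990, with its conclusion kept EXACT in `K[X]`:
`natDegree g'_j ≤ p²` and `Σ C(c'_j)·g'_j² = F̄_p`), both verbatim from `Cruxes/CharPSparseSOS/Strategist_Sketch.lean`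
(the second is also, byte for byte, the hypothesis of the landed `SublinearShadowSketch.sublinearShadow_of_ordered`).
Conclusion: the route decl `FeketeSOSHard`.  Proof = the route's `closes` bookkeeping: with `M := A + 1`,
`δ := min (1/4) (δ'/(2M))` and `p ≥ max p₀' p₁ N 2` where `(2^A)^{2/δ'} ≤ N`, a complex representation with
`s ≤ p^δ` squares and support-sum `S < p^{1/2+δ} ≤ p^{3/4}` has `S⁴ ≤ p³`, so the ordered shadow gives an exact
char-`p` representation with `d ≤ (s+1)^A ≤ 2^A p^{δA} ≤ p^{δ'}` squares and support-sum `≤ (s+1)^A·S <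
p^{δ'/2}·p^{δA}·p^{1/2+δ} ≤ p^{1/2+δ'}`, contradicting (★ord). -/
theorem feketeSOSHard_of_ordered : (∃ δ : ℝ, 0 < δ ∧ ∃ p₀ : ℕ, ∀ (p : ℕ) [Fact p.Prime], p₀ ≤ p → ∀ (K : Type) [Field K] [CharP K p] (s : ℕ) (c : Fin s → K) (g : Fin s → Polynomial K), (s : ℝ) ≤ (p : ℝ) ^ δ → (∀ i, (g i).natDegree ≤ p ^ 2) → (∑ i, Polynomial.C (c i) * g i ^ 2) = ∑ m ∈ Finset.range p, Polynomial.C ((legendreSym p m : ℤ) : K) * Polynomial.X ^ m → (p : ℝ) ^ (1 / 2 + δ) ≤ ∑ i, ((g i).support.card : ℝ)) → (∃ A p₁ : ℕ, ∀ (p : ℕ) [Fact p.Prime], p₁ ≤ p → ∀ (s : ℕ) (c : Fin s → ℂ) (g : Fin s → Polynomial ℂ), (∀ i, (g i).natDegree ≤ p ^ 2) → (∑ i, (g i).support.card) ^ 4 ≤ p ^ 3 → (∑ i, Polynomial.C (c i) * g i ^ 2) = ∑ m ∈ Finset.range p, Polynomial.C ((legendreSym p m : ℤ) : ℂ) * Polynomial.X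 ^ m → ∃ (K : Type) (_ : Field K) (_ : CharP K p) (d : ℕ) (c' : Fin d → K) (g' : Fin d → Polynomial K), d ≤ (s + 1) ^ A ∧ (∀ j, (g' j).natDegree ≤ p ^ 2) ∧ (∑ j, (g' j).support.card) ≤ (s + 1) ^ A * ∑ i, (g i).support.card ∧ (∑ j, Polynomial.C (c' j) * g' j ^ 2) = ∑ m ∈ Finset.range p, Polynomial.C ((legendreSym p m : ℤ) : K) * Polynomial.X ^ m) → Summit.ValiantsHypothesis.ValiantsHypothesis.Theses.FeketeSOS.FeketeSOSHard := by
  intro h₂ h₃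
  obtain ⟨δ', hδ', p₀', Hstar⟩ := h₂
  obtain ⟨A, p₁, Hsh⟩ := h₃
  set M : ℝ := (A : ℝ) + 1 with hM
  have hM0 : (0 : ℝ) < M := by rw [hM]; have : (0:ℝ) ≤ A := Nat.cast_nonneg A; linarith
  set δ : ℝ := min (1 / 4) (δ' / (2 * M)) with hδdef
  have hδpos : 0 < δ := lt_min (by norm_num) (by positivity)
  have hδ4 : δ ≤ 1 / 4 := min_le_left _ _
  have hδM : δ * M ≤ δ' / 2 := by
    have h1 : δ ≤ δ' / (2 * M) := min_le_right _ _
    calc δ * M ≤ δ' / (2 * M) * M := mul_le_mul_of_nonneg_right h1 hM0.le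
      _ = δ' / 2 := by field_simp
  have hδA : δ * A ≤ δ' / 2 := by
    have : δ * (A : ℝ) ≤ δ * M := mul_le_mul_of_nonneg_left (by rw [hM]; linarith) hδpos.le
    exact this.trans hδM
  obtain ⟨N, hN⟩ : ∃ N : ℕ, ((2 : ℝ) ^ A) ^ (2 / δ') ≤ (N : ℝ) := ⟨_, Nat.le_ceil _⟩
  refine ⟨δ, hδpos, max p₀' (max p₁ (max N 2)), ?_⟩
  intro p _ hp s c g hs hdeg hrep
  have hprime : p.Prime := Fact.out
  have hp₀' : p₀' ≤ p := le_trans (le_max_left _ _) hp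
  have hp₁ : p₁ ≤ p := le_trans (le_trans (le_max_left _ _) (le_max_right _ _)) hp
  have hpN : N ≤ p :=
    le_trans (le_trans (le_trans (le_max_left _ _) (le_max_right _ _)) (le_max_right _ _)) hp
  have hp1 : (1 : ℝ) ≤ (p : ℝ) := by exact_mod_cast hprime.one_lt.le
  have hp0 : (0 : ℝ) < (p : ℝ) := by linarith
  have h2A : (2 : ℝ) ^ A ≤ (p : ℝ) ^ (δ' / 2) := by
    have h2A0 : (0 : ℝ) ≤ (2 : ℝ) ^ A := by positivity
    have hbase : ((2 : ℝ) ^ A) ^ (2 / δ') ≤ (p : ℝ) := hN.trans (by exact_mod_cast hpN)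
    have hb0 : (0 : ℝ) ≤ ((2 : ℝ) ^ A) ^ (2 / δ') := Real.rpow_nonneg h2A0 _
    have hmono : (((2 : ℝ) ^ A) ^ (2 / δ')) ^ (δ' / 2) ≤ (p : ℝ) ^ (δ' / 2) :=
      Real.rpow_le_rpow hb0 hbase (by positivity)
    have hid : (((2 : ℝ) ^ A) ^ (2 / δ')) ^ (δ' / 2) = (2 : ℝ) ^ A := by
      rw [← Real.rpow_mul h2A0]
      have : (2 / δ') * (δ' / 2) = 1 := by field_simp
      rw [this, Real.rpow_one]
    rw [hid] at hmono
    exact hmono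
  by_contra hlt
  push Not at hlt
  set S : ℕ := ∑ i, (g i).support.card with hS
  have hcastS : (∑ i, ((g i).support.card : ℝ)) = (S : ℝ) := by rw [hS]; push_cast; rfl
  rw [hcastS] at hlt
  have h34 : (p : ℝ) ^ (1 / 2 + δ) ≤ (p : ℝ) ^ (3 / 4 : ℝ) :=
    Real.rpow_le_rpow_of_exponent_le hp1 (by linarith)
  have hSlt : (S : ℝ) < (p : ℝ) ^ (3 / 4 : ℝ) := lt_of_lt_of_le hlt h34
  have hS4 : S ^ 4 ≤ p ^ 3 := by
    have hS0 : (0 : ℝ) ≤ (S : ℝ) := Nat.cast_nonneg S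
    have h4 : (S : ℝ) ^ (4 : ℕ) < ((p : ℝ) ^ (3 / 4 : ℝ)) ^ (4 : ℕ) :=
      pow_lt_pow_left₀ hSlt hS0 (by norm_num)
    have e1 : ((p : ℝ) ^ (3 / 4 : ℝ)) ^ (4 : ℕ) = (p : ℝ) ^ (3 : ℕ) := by
      rw [← Real.rpow_natCast, ← Real.rpow_mul hp0.le]; norm_num
    rw [e1] at h4
    have : ((S ^ 4 : ℕ) : ℝ) < ((p ^ 3 : ℕ) : ℝ) := by push_cast; exact h4
    exact le_of_lt (by exact_mod_cast this)
  obtain ⟨K, instF, instC, d, c', g', hd, hdeg', hsupp', heq'⟩ := Hsh p hp₁ s c g hdeg hS4 hrep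
  have hpδ1 : (1 : ℝ) ≤ (p : ℝ) ^ δ := Real.one_le_rpow hp1 hδpos.le
  have hs1 : (s : ℝ) + 1 ≤ 2 * (p : ℝ) ^ δ := by linarith
  have hsA : ((s : ℝ) + 1) ^ A ≤ (2 : ℝ) ^ A * (p : ℝ) ^ (δ * A) := by
    have h := pow_le_pow_left₀ (by positivity) hs1 A
    have e : (2 * (p : ℝ) ^ δ) ^ A = (2 : ℝ) ^ A * (p : ℝ) ^ (δ * A) := by
      rw [mul_pow, ← Real.rpow_natCast ((p : ℝ) ^ δ) A, ← Real.rpow_mul hp0.le]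
    rw [e] at h; exact h
  have hbound : (2 : ℝ) ^ A * (p : ℝ) ^ (δ * A) ≤ (p : ℝ) ^ (δ' / 2) * (p : ℝ) ^ (δ * A) :=
    mul_le_mul_of_nonneg_right h2A (Real.rpow_nonneg hp0.le _)
  have hdR : (d : ℝ) ≤ (p : ℝ) ^ δ' := by
    have h1 : (d : ℝ) ≤ ((s : ℝ) + 1) ^ A := by
      have : ((d : ℕ) : ℝ) ≤ (((s + 1) ^ A : ℕ) : ℝ) := by exact_mod_cast hd
      push_cast at this; exact this
    have h2 : (p : ℝ) ^ (δ' / 2) * (p : ℝ) ^ (δ * A) ≤ (p : ℝ) ^ δ' := by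
      rw [← Real.rpow_add hp0]
      exact Real.rpow_le_rpow_of_exponent_le hp1 (by linarith)
    exact h1.trans (hsA.trans (hbound.trans h2))
  have hstarK := Hstar p hp₀' K d c' g' hdR hdeg' heq'
  have hsum' : (∑ j, ((g' j).support.card : ℝ)) ≤ ((s : ℝ) + 1) ^ A * (S : ℝ) := by
    have : ((∑ j, (g' j).support.card : ℕ) : ℝ) ≤ (((s + 1) ^ A * S : ℕ) : ℝ) := by exact_mod_cast hsupp'
    push_cast at this
    have e : (∑ j, ((g' j).support.card : ℝ)) = ((∑ j, (g' j).support.card : ℕ) : ℝ) := by push_cast; rfl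
    rw [e]; push_cast; exact this
  have hS0 : (0 : ℝ) ≤ (S : ℝ) := Nat.cast_nonneg S
  have hlt2 : ((s : ℝ) + 1) ^ A * (S : ℝ) <
      (p : ℝ) ^ (δ' / 2) * (p : ℝ) ^ (δ * A) * (p : ℝ) ^ (1 / 2 + δ) := by
    have hc : ((s : ℝ) + 1) ^ A ≤ (p : ℝ) ^ (δ' / 2) * (p : ℝ) ^ (δ * A) := hsA.trans hbound
    have hcpos : (0 : ℝ) < (p : ℝ) ^ (δ' / 2) * (p : ℝ) ^ (δ * A) := by positivity
    calc ((s : ℝ) + 1) ^ A * (S : ℝ) ≤ (p : ℝ) ^ (δ' / 2) * (p : ℝ) ^ (δ * A) * (S : ℝ) :=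
          mul_le_mul_of_nonneg_right hc hS0
      _ < (p : ℝ) ^ (δ' / 2) * (p : ℝ) ^ (δ * A) * (p : ℝ) ^ (1 / 2 + δ) :=
          mul_lt_mul_of_pos_left hlt hcpos
  have hexp : (p : ℝ) ^ (δ' / 2) * (p : ℝ) ^ (δ * A) * (p : ℝ) ^ (1 / 2 + δ) ≤
      (p : ℝ) ^ (1 / 2 + δ') := by
    rw [← Real.rpow_add hp0, ← Real.rpow_add hp0]
    exact Real.rpow_le_rpow_of_exponent_le hp1 (by linarith)
  exact lt_irrefl _ (lt_of_le_of_lt hstarK (lt_of_le_of_lt hsum' (lt_of_lt_of_le hlt2 hexp)))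

/-- **The re-glued deciding theorem, shape-checked.**  With `SOSMagnification` (stmt-3995: X ⇒ VP ≠ VNP, closed)
the ordered pair decides the sub-problem Statement: `closes h₁ h₂' h₃' := valiantsHypothesis_of_ordered h₁ h₂' h₃'`
once the planner files (★ord) and `SublinearShadowOrdered` as items with exactly these bodies. -/
theorem valiantsHypothesis_of_ordered : Summit.ValiantsHypothesis.ValiantsHypothesis.Theses.FeketeSOS.SOSMagnification → (∃ δ : ℝ, 0 < δ ∧ ∃ p₀ : ℕ, ∀ (p : ℕ) [Fact p.Prime], p₀ ≤ p → ∀ (K : Type) [Field K] [CharP K p] (s : ℕ) (c : Fin s → K) (g : Fin s → Polynomial K), (s : ℝ) ≤ (p : ℝ) ^ δ → (∀ i, (g i).natDegree ≤ p ^ 2) → (∑ i, Polynomial.C (c i) * g i ^ 2) = ∑ m ∈ Finset.range p, Polynomial.C ((legendreSym p m : ℤ) : K) * Polynomial.X ^ m → (p : ℝ) ^ (1 / 2 + δ) ≤ ∑ i, ((g i).support.card : ℝ)) → (∃ A p₁ : ℕ, ∀ (p : ℕ) [Fact p.Prime], p₁ ≤ p → ∀ (s : ℕ) (c : Fin s →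 ℂ) (g : Fin s → Polynomial ℂ), (∀ i, (g i).natDegree ≤ p ^ 2) → (∑ i, (g i).support.card) ^ 4 ≤ p ^ 3 → (∑ i, Polynomial.C (c i) * g i ^ 2) = ∑ m ∈ Finset.range p, Polynomial.C ((legendreSym p m : ℤ) : ℂ) * Polynomial.X ^ m → ∃ (K : Type) (_ : Field K) (_ : CharP K p) (d : ℕ) (c' : Fin d → K) (g' : Fin d → Polynomial K), d ≤ (s + 1) ^ A ∧ (∀ j, (g' j).natDegree ≤ p ^ 2) ∧ (∑ j, (g' j).support.card) ≤ (s + 1) ^ A * ∑ i, (g i).support.card ∧ (∑ j, Polynomial.C (c' j) * g' j ^ 2) = ∑ m ∈ Finset.range p, Polynomial.C ((legendreSym p m : ℤ) : K) * Polynomial.X ^ m) → _root_.ValiantsHypothesis :=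
  fun h₁ h₂ h₃ =>
  h₁ (feketeSOSHard_of_ordered h₂ h₃)

end Summit.ValiantsHypothesis.ValiantsHypothesis.Theorems.CharPSparseSOSTwoCusp
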